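import Literature.RepresentationTheory.FiniteGroups.GuralnickHerzigTiepAdequacy
import Literature.NumberTheory.GaloisRepresentations.PrimeDegreeCyclicSylowFree
import Literature.GroupTheory.SpecificGroups.AlternatingSixPSL2Nine
import HarnessLib

/-!
# `IsGHTAdequate ρ ↔ Subgroup.IsExtendedAdequate ρ(G)`: the two renderings of GHT 2017 adequacy agree

Topic `RepresentationTheory/FiniteGroups`; a sibling of `GuralnickHerzigTiepAdequacy.lean`
(`IsGHTAdequate ρ` and the named fact `GuralnickHerzigTiep2017_thm_1_7`, Guralnick–Herzig–Tiep
2017, Thm 1.7, rendered on the representation `ρ : G →* GL_n(k)` with clause (ii) written on LIFTS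
of cocycles to `M_n(k)`), bridging it to the other rendering of the same printed notion,
`Literature.NumberTheory.GaloisRepresentations.Subgroup.IsExtendedAdequate` of the IMAGE
`ρ(G) ≤ GL_n(k)` (`ExtendedAdequateSubgroup.lean`: clause (ii) as Mathlib's
`cocycles₁ ≤ coboundaries₁` for the representation `ad/Z`), which carries the named fact
`ght2017_adequate_or_index_p_or_psl29` (`AdequacyDegreeP.lean`) and its classification-free
partial proofs.  Theorems only.

* `isGHTAdequate_iff_isExtendedAdequate_range` — for a FAITHFUL `ρ` the two notions coincide
  (clause by clause: `addMonoidHom_eq_zero_iff_range`, `ghtCocycleClause_iff_range`,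
  `ghtSpanClause_iff_range`; faithfulness is needed for (i) and (ii): for the image, `ker ρ` is
  invisible).
* Transported to the `IsGHTAdequate` vocabulary, the unconditional parts of Theorem 1.7 proved in
  `Literature/NumberTheory/GaloisRepresentations/`: `isGHTAdequate_or_index_two` (Thm 1.7 for
  `p = 2`, `AdequacyDegreeTwo.lean`), `isGHTAdequate_or_index_p_of_isSolvable` (Thm 1.7 for
  solvable `G`), `isGHTAdequate_or_index_p_of_not_sq_dvd_of_span_eq_top` (Thm 1.7 for `p ∥ |G|`
  granted weak adequacy, `PrimeDegreeCyclicSylowFree.lean`), and the exclusivity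
  `not_isGHTAdequate_of_comm_normal_index` ("(b) excludes (a)", the conjunct `¬(A ∧ B)` of
  `ExactlyOneOfThree` in `GuralnickHerzigTiep2017_thm_1_7`).
* The two NAMED FACTS compared: `nonempty_mulEquiv_PSL_iff_alternatingGroup` (alternative (c):
  `projectiveImage ρ ≃* PSL(2, 𝔽₉)` iff `≃* A₆`, by the exceptional isomorphism
  `AltSixPSL.nonempty_alternatingGroup_mulEquiv_PSL`); `ght2017_adequate_or_index_p_or_psl29_of_thm_1_7`
  (`GuralnickHerzigTiep2017_thm_1_7` IMPLIES `ght2017_adequate_or_index_p_or_psl29.{0,0}`: one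
  debt); `thm_1_7_disjunction_of_ght2017`, `not_index_p_and_nonempty_mulEquiv_PSL` ("(b) excludes
  (c)"), and `thm_1_7_iff_ght2017_and_exclusive`: the "precisely one" fact is the disjunction fact
  plus the single unproved exclusivity "(a) excludes (c)".

## References

* [GuralnickHerzigTiep2017] R. M. Guralnick, F. Herzig, P. H. Tiep, *Adequate subgroups and
  indecomposable modules*, J. Eur. Math. Soc. 19 (2017) 1231–1291 = arXiv:1405.0043, §1 p. 3
  (definition of adequate), Theorem 1.7.
* [Thorne2017TwoAdic] J. Thorne, Math. Z. 285 (2017), Def. 2.20 (the same notion).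
-/

noncomputable section

open scoped MatrixGroups

namespace Literature.RepresentationTheory.FiniteGroups

open Literature.NumberTheory.GaloisRepresentations

universe u v

variable {G : Type u} [Group G] {k : Type v} [Field k] {n : ℕ}

/-! ### Clause (i) -/

/-- Clause (i) for `G` and for its faithful image agree: `Hom(G, k) = 0 ↔ Hom(ρ(G), k) = 0`.
[folklore] -/
theorem addMonoidHom_eq_zero_iff_range (ρ : G →* GL (Fin n) k) (hinj : Function.Injective ρ) :
    (∀ f : Additive G →+ k, f = 0) ↔ (∀ f : Additive ρ.range →+ k, f = 0) := by
  let e : G ≃* ρ.range := MonoidHom.ofInjective hinj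
  constructor
  · intro h f
    let f' : Additive G →+ k :=
      AddMonoidHom.mk' (fun x => f (Additive.ofMul (e (Additive.toMul x)))) (by
        intro a b
        simp only [toMul_add, map_mul, ofMul_mul, map_add])
    refine AddMonoidHom.ext fun y => ?_
    have hy : f' (Additive.ofMul (e.symm (Additive.toMul y))) = 0 := by rw [h f']; rfl
    change f (Additive.ofMul (e (Additive.toMul (Additive.ofMul (e.symm (Additive.toMul y)))))) = 0
      at hy
    rw [toMul_ofMul, MulEquiv.apply_symm_apply, ofMul_toMul] at hy
    rw [hy, AddMonoidHom.zero_apply]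
  · intro h f
    let f' : Additive ρ.range →+ k :=
      AddMonoidHom.mk' (fun y => f (Additive.ofMul (e.symm (Additive.toMul y)))) (by
        intro a b
        simp only [toMul_add, map_mul, ofMul_mul, map_add])
    refine AddMonoidHom.ext fun x => ?_
    have hx : f' (Additive.ofMul (e (Additive.toMul x))) = 0 := by rw [h f']; rfl
    change f (Additive.ofMul (e.symm (Additive.toMul (Additive.ofMul (e (Additive.toMul x)))))) = 0
      at hx
    rw [toMul_ofMul, MulEquiv.symm_apply_apply, ofMul_toMul] at hx
    rw [hx, AddMonoidHom.zero_apply]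

/-! ### Clause (iii) -/

/-- The span of the semisimple `ρ(g)` is the span of the semisimple elements of `ρ(G)` (the
same set of matrices). [folklore] -/
theorem span_semisimple_eq_semisimpleSpan_range (ρ : G →* GL (Fin n) k) :
    Submodule.span k {M : Matrix (Fin n) (Fin n) k |
        ∃ g : G, (orderOf (ρ g)).Coprime (ringChar k) ∧ M = (ρ g : Matrix (Fin n) (Fin n) k)} =
      Subgroup.semisimpleSpan ρ.range := by
  rw [Subgroup.semisimpleSpan_def]
  congr 1
  ext M
  constructor
  · rintro ⟨g, hg, rfl⟩
    exact ⟨⟨ρ g, g, rfl⟩, hg, rfl⟩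
  · rintro ⟨⟨_, g, rfl⟩, hg, rfl⟩
    exact ⟨g, hg, rfl⟩

/-- Clause (iii) for `ρ` and for `ρ(G)` agree. [folklore] -/
theorem ghtSpanClause_iff_range (ρ : G →* GL (Fin n) k) :
    Submodule.span k {M : Matrix (Fin n) (Fin n) k |
        ∃ g : G, (orderOf (ρ g)).Coprime (ringChar k) ∧ M = (ρ g : Matrix (Fin n) (Fin n) k)} = ⊤ ↔
      Subgroup.semisimpleSpan ρ.range = ⊤ := by
  rw [span_semisimple_eq_semisimpleSpan_range]

/-! ### Clause (ii) -/

/-- Clause (ii) for a faithful `ρ`, written on lifts of cocycles to `M_n(k)` as in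
`IsGHTAdequate`, is Mathlib's `H¹(ρ(G), ad/Z) = 0` (`cocycles₁ ≤ coboundaries₁` for
`Subgroup.adModScalarRep ρ(G)`).  (A cocycle of `ρ(G) ≅ G` with values in `M_n(k)/k` lifts to a
map `G → M_n(k)` satisfying the cocycle identity modulo scalars, and conversely; coboundaries
correspond likewise.) [folklore] -/
theorem ghtCocycleClause_iff_range (ρ : G →* GL (Fin n) k) (hinj : Function.Injective ρ) :
    (∀ f : G → Matrix (Fin n) (Fin n) k,
      (∀ g h : G, ∃ c : k,
        f (g * h) = f g + (ρ g : Matrix (Fin n) (Fin n) k) * f h *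
          ((ρ g)⁻¹ : GL (Fin n) k) + c • (1 : Matrix (Fin n) (Fin n) k)) →
      ∃ (m : Matrix (Fin n) (Fin n) k) (c : G → k), ∀ g : G,
        f g = (ρ g : Matrix (Fin n) (Fin n) k) * m * ((ρ g)⁻¹ : GL (Fin n) k) - m +
          c g • (1 : Matrix (Fin n) (Fin n) k)) ↔
    groupCohomology.cocycles₁ (Rep.of (Subgroup.adModScalarRep ρ.range)) ≤
      groupCohomology.coboundaries₁ (Rep.of (Subgroup.adModScalarRep ρ.range)) := by
  classical
  let e : G ≃* ρ.range := MonoidHom.ofInjective hinj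
  have he : ∀ g : G, ((e g : ρ.range) : GL (Fin n) k) = ρ g := fun g => rfl
  have hes : ∀ x : ρ.range, ρ (e.symm x) = (x : GL (Fin n) k) :=
    fun x => MonoidHom.apply_ofInjective_symm hinj x
  set S : Submodule k (Matrix (Fin n) (Fin n) k) := scalarMatrices (Fin n) k with hS
  -- a set-theoretic section of `M_n(k) → M_n(k)/k`
  obtain ⟨l, hl⟩ := (Submodule.mkQ_surjective S).hasRightInverse
  have hl' : ∀ x : Matrix (Fin n) (Fin n) k ⧸ S, Submodule.Quotient.mk (l x) = x := fun x => hl x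
  have hmk_eq : ∀ M N : Matrix (Fin n) (Fin n) k,
      (Submodule.Quotient.mk M : Matrix (Fin n) (Fin n) k ⧸ S) = Submodule.Quotient.mk N →
        ∃ c : k, M = N + c • 1 := by
    intro M N h
    rw [Submodule.Quotient.eq, hS, mem_scalarMatrices_iff] at h
    obtain ⟨c, hc⟩ := h
    exact ⟨c, by rw [hc, add_sub_cancel]⟩
  rw [cocycles₁_le_coboundaries₁_iff_forall]
  constructor
  · intro hGHT F hF
    change ∀ x y : ρ.range, F (x * y) = Subgroup.adModScalarRep ρ.range x (F y) + F x at hF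
    change ∃ m, ∀ x : ρ.range, F x = Subgroup.adModScalarRep ρ.range x m - m
    -- lift the cocycle to `G → M_n(k)`
    set f : G → Matrix (Fin n) (Fin n) k := fun g => l (F (e g)) with hf
    have hfF : ∀ g : G, (Submodule.Quotient.mk (f g) : Matrix (Fin n) (Fin n) k ⧸ S) = F (e g) :=
      fun g => hl' _
    have hcoc : ∀ g h : G, ∃ c : k,
        f (g * h) = f g + (ρ g : Matrix (Fin n) (Fin n) k) * f h * ((ρ g)⁻¹ : GL (Fin n) k) +
          c • (1 : Matrix (Fin n) (Fin n) k) := by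
      intro g h
      apply hmk_eq
      rw [hfF, map_mul, hF, Submodule.Quotient.mk_add, ← hfF h, Subgroup.adModScalarRep_apply_mk,
        he, hfF g, add_comm]
    obtain ⟨m, c, hm⟩ := hGHT f hcoc
    refine ⟨Submodule.Quotient.mk m, fun x => ?_⟩
    obtain ⟨g, rfl⟩ : ∃ g, e g = x := ⟨e.symm x, e.apply_symm_apply x⟩
    rw [← hfF, hm g, Subgroup.adModScalarRep_apply_mk, he, Submodule.Quotient.mk_add,
      Submodule.Quotient.mk_sub, Submodule.Quotient.mk_smul]
    have h1 : (Submodule.Quotient.mk (1 : Matrix (Fin n) (Fin n) k) : Matrix (Fin n) (Fin n) k ⧸ S) =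
        0 := by
      rw [Submodule.Quotient.mk_eq_zero, hS]
      exact Submodule.mem_span_singleton_self _
    rw [h1, smul_zero, add_zero]
  · intro hH f hf
    choose c hc using hf
    -- push the lifted cocycle down to `ρ(G) → M_n(k)/k`
    set F : ρ.range → Matrix (Fin n) (Fin n) k ⧸ S :=
      fun x => Submodule.Quotient.mk (f (e.symm x)) with hFdef
    have hF : ∀ x y : ρ.range, F (x * y) = Subgroup.adModScalarRep ρ.range x (F y) + F x := by
      intro x y
      simp only [hFdef]
      rw [map_mul, hc, Subgroup.adModScalarRep_apply_mk, ← hes x, Submodule.Quotient.mk_add,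
        Submodule.Quotient.mk_add, Submodule.Quotient.mk_smul]
      have h1 : (Submodule.Quotient.mk (1 : Matrix (Fin n) (Fin n) k) :
          Matrix (Fin n) (Fin n) k ⧸ S) = 0 := by
        rw [Submodule.Quotient.mk_eq_zero, hS]
        exact Submodule.mem_span_singleton_self _
      rw [h1, smul_zero, add_zero, add_comm]
    obtain ⟨M, hM⟩ := hH F hF
    obtain ⟨m, rfl⟩ := Submodule.mkQ_surjective S M
    have key : ∀ g : G, ∃ d : k,
        f g = (ρ g : Matrix (Fin n) (Fin n) k) * m * ((ρ g)⁻¹ : GL (Fin n) k) - m + d • 1 := by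
      intro g
      apply hmk_eq
      have h1 := hM (e g)
      simp only [hFdef, MulEquiv.symm_apply_apply] at h1
      rw [h1, Submodule.mkQ_apply, Subgroup.adModScalarRep_apply_mk, he, Submodule.Quotient.mk_sub]
    choose d hd using key
    exact ⟨m, d, hd⟩

/-! ### The bridge -/

/-- **The two tree renderings of GHT 2017 adequacy agree for a faithful representation:**
`IsGHTAdequate ρ ↔ Subgroup.IsExtendedAdequate ρ(G)`.  Hence every result on the image
(`Literature/NumberTheory/GaloisRepresentations/`: `AdequacyDegreeP.lean`, `AdequacyDegreeTwo.lean`,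
`PrimeDegreePrimitiveQuasisimple.lean`, `PrimeDegreeCyclicSylowFree.lean`, …) applies to
`IsGHTAdequate` and to the named fact `GuralnickHerzigTiep2017_thm_1_7`.
[cite: GuralnickHerzigTiep2017, §1 p. 3 (definition of adequate)] -/
theorem isGHTAdequate_iff_isExtendedAdequate_range (ρ : G →* GL (Fin n) k)
    (hinj : Function.Injective ρ) :
    IsGHTAdequate ρ ↔ Subgroup.IsExtendedAdequate ρ.range := by
  constructor
  · intro h
    exact ⟨(addMonoidHom_eq_zero_iff_range ρ hinj).1 h.addMonoidHom_eq_zero,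
      (ghtCocycleClause_iff_range ρ hinj).1 h.exists_sub_coboundary_mem_scalar,
      (ghtSpanClause_iff_range ρ).1 h.span_eq_top⟩
  · intro h
    exact ⟨(addMonoidHom_eq_zero_iff_range ρ hinj).2 h.addMonoidHom_eq_zero,
      (ghtCocycleClause_iff_range ρ hinj).2 h.cocycles₁_le_coboundaries₁,
      (ghtSpanClause_iff_range ρ).2 h.semisimpleSpan_eq_top⟩

/-! ### Unconditional parts of `GuralnickHerzigTiep2017_thm_1_7`, transported -/

/-- **Theorem 1.7 for `p = 2`, in the `IsGHTAdequate` vocabulary** (classification-free,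
`ght2017_adequate_or_index_two`). [cite: GuralnickHerzigTiep2017, Theorem 1.7 (the case `p = 2`)] -/
theorem isGHTAdequate_or_index_two {k : Type v} [Field k] [CharP k 2] {G : Type u} [Group G]
    [Finite G] (ρ : G →* GL (Fin 2) k) (hinj : Function.Injective ρ) (hirr : IsAbsIrreducible ρ) :
    IsGHTAdequate ρ ∨
      ∃ N : Subgroup G, N.Normal ∧ (∀ x ∈ N, ∀ y ∈ N, x * y = y * x) ∧ N.index = 2 := by
  rcases ght2017_adequate_or_index_two k G ρ hinj hirr with h | h
  · exact Or.inl ((isGHTAdequate_iff_isExtendedAdequate_range ρ hinj).2 h)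
  · exact Or.inr h

/-- **Theorem 1.7 for solvable `G`, in the `IsGHTAdequate` vocabulary** (classification-free,
`isExtendedAdequate_or_index_p_of_isSolvable`). [cite: GuralnickHerzigTiep2017, Theorem 1.7] -/
theorem isGHTAdequate_or_index_p_of_isSolvable {p : ℕ} [Fact p.Prime] {k : Type v} [Field k]
    [CharP k p] {G : Type u} [Group G] [Finite G] [IsSolvable G] (ρ : G →* GL (Fin p) k)
    (hinj : Function.Injective ρ) (hirr : IsAbsIrreducible ρ) :
    IsGHTAdequate ρ ∨
      ∃ N : Subgroup G, N.Normal ∧ (∀ x ∈ N, ∀ y ∈ N, x * y = y * x) ∧ N.index = p := by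
  rcases isExtendedAdequate_or_index_p_of_isSolvable ρ hinj hirr with h | h
  · exact Or.inl ((isGHTAdequate_iff_isExtendedAdequate_range ρ hinj).2 h)
  · exact Or.inr h

/-- **Theorem 1.7 for `p ∥ |G|` granted weak adequacy, in the `IsGHTAdequate` vocabulary**
(classification-free, `isExtendedAdequate_or_index_p_of_not_sq_dvd_of_semisimpleSpan`): clauses
(i), (ii) come for free when `p² ∤ |G|`. [cite: GuralnickHerzigTiep2017, Theorem 1.7,
Lemmas 6.2–6.3] -/
theorem isGHTAdequate_or_index_p_of_not_sq_dvd_of_span_eq_top {p : ℕ} [Fact p.Prime]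
    {k : Type v} [Field k] [CharP k p] {G : Type u} [Group G] [Finite G] (ρ : G →* GL (Fin p) k)
    (hinj : Function.Injective ρ) (hirr : IsAbsIrreducible ρ) (hp2 : ¬p ^ 2 ∣ Nat.card G)
    (hw : Submodule.span k {M : Matrix (Fin p) (Fin p) k |
        ∃ g : G, (orderOf (ρ g)).Coprime (ringChar k) ∧ M = (ρ g : Matrix (Fin p) (Fin p) k)} = ⊤) :
    IsGHTAdequate ρ ∨
      ∃ N : Subgroup G, N.Normal ∧ (∀ x ∈ N, ∀ y ∈ N, x * y = y * x) ∧ N.index = p := by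
  rcases isExtendedAdequate_or_index_p_of_not_sq_dvd_of_semisimpleSpan ρ hinj hirr hp2
    ((ghtSpanClause_iff_range ρ).1 hw) with h | h
  · exact Or.inl ((isGHTAdequate_iff_isExtendedAdequate_range ρ hinj).2 h)
  · exact Or.inr h

/-- **"(b) excludes (a)" in the `IsGHTAdequate` vocabulary** — the conjunct `¬(A ∧ B)` of the
"precisely one" in `GuralnickHerzigTiep2017_thm_1_7`, unconditionally
(`not_isExtendedAdequate_of_comm_normal_index`). [cite: GuralnickHerzigTiep2017, Theorem 1.7
("precisely one"), Proposition 6.6 (proof, first paragraph)] -/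
theorem not_isGHTAdequate_of_comm_normal_index {p : ℕ} [Fact p.Prime] {k : Type v} [Field k]
    [CharP k p] {G : Type u} [Group G] (ρ : G →* GL (Fin p) k) (hinj : Function.Injective ρ)
    (N : Subgroup G) [N.Normal] (hN : ∀ x ∈ N, ∀ y ∈ N, x * y = y * x) (hidx : N.index = p) :
    ¬IsGHTAdequate ρ := fun h =>
  not_isExtendedAdequate_of_comm_normal_index p k G ρ hinj N hN hidx
    ((isGHTAdequate_iff_isExtendedAdequate_range ρ hinj).1 h)

/-! ### Alternative (c): `PSL₂(𝔽₉)` versus `A₆` -/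

/-- The projective image `projectiveImage ρ ≤ PGL_n(k)` of `ProjectiveType.lean` is the subgroup
`ρ(G) · Z / Z` of `GL_n(k)/Z` used in `ght2017_adequate_or_index_p_or_psl29` (same group, as
`PGL_n(k)` is by definition `GL_n(k)/Z(GL_n(k))`). [folklore] -/
theorem projectiveImage_eq_map_mk' {n : ℕ} (ρ : G →* GL (Fin n) k) :
    projectiveImage ρ = ρ.range.map (QuotientGroup.mk' (Subgroup.center (GL (Fin n) k))) :=
  projectiveImage_eq_map_range ρ

/-- `|𝔽₉| = 9` for Mathlib's `GaloisField 3 2`. [folklore] -/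
theorem natCard_galoisField_three_two : Nat.card (GaloisField 3 2) = 9 := by
  haveI : Fact (Nat.Prime 3) := ⟨Nat.prime_three⟩
  rw [GaloisField.card 3 2 two_ne_zero]
  norm_num

/-- **The two phrasings of alternative (c) agree:** the image of `G` in `PGL(V)` "is `PSL₂(9)`"
(`GuralnickHerzigTiep2017_thm_1_7`: `projectiveImage ρ ≃* PSL(2, 𝔽₉)`) iff it "is `A₆`"
(`ght2017_adequate_or_index_p_or_psl29`: `≃* alternatingGroup (Fin 6)`), by the exceptional
isomorphism `A₆ ≅ PSL₂(𝔽₉)` (`AltSixPSL.nonempty_alternatingGroup_mulEquiv_PSL`, Wilson §3.3.5).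
[cite: GuralnickHerzigTiep2017, proof of Theorem 6.15 ("`H = PSL₂(9) ≅ 𝔄₆`", p. 24)] -/
theorem nonempty_mulEquiv_PSL_iff_alternatingGroup {n : ℕ} (ρ : G →* GL (Fin n) k) :
    Nonempty (projectiveImage ρ ≃* PSL(2, GaloisField 3 2)) ↔
      Nonempty (↥(ρ.range.map (QuotientGroup.mk' (Subgroup.center (GL (Fin n) k)))) ≃*
        ↥(alternatingGroup (Fin 6))) := by
  obtain ⟨e₉⟩ := Literature.GroupTheory.SpecificGroups.AltSixPSL.nonempty_alternatingGroup_mulEquiv_PSL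
    (GaloisField 3 2) natCard_galoisField_three_two
  have e₀ : ↥(projectiveImage ρ) ≃*
      ↥(ρ.range.map (QuotientGroup.mk' (Subgroup.center (GL (Fin n) k)))) :=
    MulEquiv.subgroupCongr (projectiveImage_eq_map_mk' ρ)
  constructor
  · rintro ⟨e⟩
    exact ⟨e₀.symm.trans (e.trans e₉.symm)⟩
  · rintro ⟨e⟩
    exact ⟨e₀.trans (e.trans e₉)⟩

/-! ### The two named facts compared -/

/-- **`GuralnickHerzigTiep2017_thm_1_7` implies `ght2017_adequate_or_index_p_or_psl29`** (at
universe level `0`, where the former lives): the "precisely one" form with `IsGHTAdequate` and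
`PSL₂(𝔽₉)` yields the disjunction form with `Subgroup.IsExtendedAdequate` and `A₆`.  So the two
named facts are ONE debt: a proof of the former discharges the latter.
[cite: GuralnickHerzigTiep2017, Theorem 1.7] -/
theorem ght2017_adequate_or_index_p_or_psl29_of_thm_1_7 (h : GuralnickHerzigTiep2017_thm_1_7) :
    ght2017_adequate_or_index_p_or_psl29.{0, 0} := by
  intro p _ k _ _ G _ _ σ hinj hirr
  obtain ⟨habc, -, -, -⟩ := h k p G σ hinj hirr
  rcases habc with ha | hb | ⟨hp, hc⟩
  · exact Or.inl ((isGHTAdequate_iff_isExtendedAdequate_range σ hinj).1 ha)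
  · exact Or.inr (Or.inl hb)
  · exact Or.inr (Or.inr ⟨hp, (nonempty_mulEquiv_PSL_iff_alternatingGroup σ).1 hc⟩)

/-- **`ght2017_adequate_or_index_p_or_psl29` gives the existence part of
`GuralnickHerzigTiep2017_thm_1_7`** ("at least one of (a), (b), (c) holds", in the `IsGHTAdequate` /
`PSL₂(𝔽₉)` vocabulary). [cite: GuralnickHerzigTiep2017, Theorem 1.7] -/
theorem thm_1_7_disjunction_of_ght2017 (h : ght2017_adequate_or_index_p_or_psl29.{0, 0})
    (k : Type) [Field k] (p : ℕ) [Fact p.Prime] [CharP k p] (G : Type) [Group G] [Finite G]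
    (ρ : G →* GL (Fin p) k) (hinj : Function.Injective ρ) (hirr : IsAbsIrreducible ρ) :
    IsGHTAdequate ρ ∨
      (∃ N : Subgroup G, N.Normal ∧ (∀ x ∈ N, ∀ y ∈ N, x * y = y * x) ∧ N.index = p) ∨
      (p = 3 ∧ Nonempty (projectiveImage ρ ≃* PSL(2, GaloisField 3 2))) := by
  rcases h p k G ρ hinj hirr with ha | hb | ⟨hp, hc⟩
  · exact Or.inl ((isGHTAdequate_iff_isExtendedAdequate_range ρ hinj).2 ha)
  · exact Or.inr (Or.inl hb)
  · exact Or.inr (Or.inr ⟨hp, (nonempty_mulEquiv_PSL_iff_alternatingGroup ρ).2 hc⟩)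

/-- **"(b) excludes (c)" in the `PSL₂(𝔽₉)` vocabulary** — the conjunct `¬(B ∧ C)` of
`GuralnickHerzigTiep2017_thm_1_7`, unconditionally
(`not_nonempty_mulEquiv_alternatingGroup_of_comm_normal_index`: `A₆` is simple and not
commutative). [cite: GuralnickHerzigTiep2017, Theorem 1.7 ("precisely one")] -/
theorem not_index_p_and_nonempty_mulEquiv_PSL {p : ℕ} [Fact p.Prime] (ρ : G →* GL (Fin p) k) :
    ¬((∃ N : Subgroup G, N.Normal ∧ (∀ x ∈ N, ∀ y ∈ N, x * y = y * x) ∧ N.index = p) ∧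
      (p = 3 ∧ Nonempty (projectiveImage ρ ≃* PSL(2, GaloisField 3 2)))) := by
  rintro ⟨⟨N, hN, hcomm, hidx⟩, -, hc⟩
  exact not_nonempty_mulEquiv_alternatingGroup_of_comm_normal_index ρ hN hcomm hidx
    ((nonempty_mulEquiv_PSL_iff_alternatingGroup ρ).1 hc)

/-- **The two named facts differ exactly by "(a) excludes (c)".**  `GuralnickHerzigTiep2017_thm_1_7`
("precisely one of (a), (b), (c)") is equivalent to the conjunction of
`ght2017_adequate_or_index_p_or_psl29` (the disjunction, at universe level `0`) and the remaining
exclusivity "an adequate `ρ` does not have projective image `PSL₂(9)` at `p = 3`" — the other two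
exclusivities being proved (`not_isGHTAdequate_of_comm_normal_index`,
`not_index_p_and_nonempty_mulEquiv_PSL`).  ("(a) excludes (c)" is GHT Cor. 9.4 (b) for
`(p, q, dim) = (3, 9, 3)` together with the uniqueness of the `3`-dimensional `3`-modular
representations of `A₆`; one embedding `Ω₃(9) ≅ A₆ < GL₃(𝔽₉)` is shown not adequate in
`AdequacyDegreeThreeException.lean`.) [cite: GuralnickHerzigTiep2017, Theorem 1.7] -/
theorem thm_1_7_iff_ght2017_and_exclusive :
    GuralnickHerzigTiep2017_thm_1_7 ↔
      (ght2017_adequate_or_index_p_or_psl29.{0, 0} ∧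
        ∀ (k : Type) [Field k] (p : ℕ) [Fact p.Prime] [CharP k p] (G : Type) [Group G] [Finite G]
          (ρ : G →* GL (Fin p) k), Function.Injective ρ → IsAbsIrreducible ρ →
            ¬(IsGHTAdequate ρ ∧ (p = 3 ∧ Nonempty (projectiveImage ρ ≃* PSL(2, GaloisField 3 2))))) := by
  constructor
  · intro h
    refine ⟨ght2017_adequate_or_index_p_or_psl29_of_thm_1_7 h, ?_⟩
    intro k _ p _ _ G _ _ ρ hinj hirr
    exact (h k p G ρ hinj hirr).2.2.1
  · rintro ⟨h, hex⟩ k _ p _ _ G _ _ ρ hinj hirr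
    refine ⟨thm_1_7_disjunction_of_ght2017 h k p G ρ hinj hirr, ?_, hex k p G ρ hinj hirr,
      not_index_p_and_nonempty_mulEquiv_PSL ρ⟩
    rintro ⟨ha, N, hN, hcomm, hidx⟩
    haveI := hN
    exact not_isGHTAdequate_of_comm_normal_index ρ hinj N hcomm hidx ha

end Literature.RepresentationTheory.FiniteGroups

end
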